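import Summits.CriticalPhenomena.PercolationContinuityZ3.Theorems.PercNearOneGluingNoHeavyLowerTailKNGoodSinkCorrelation
import HarnessLib

/-!
# `NoHeavyLowerTail` (stmt-CriticalPhenomena-4575) — pocket lift of Kozma–Nitzan's Theorem 2: the two sides as (II)-cells

Support file (`--supports stmt-CriticalPhenomena-4575`, hull-port prover `prim-hp-2`, gen 23).  No named facts, no sorries; standard axioms.
Set-theoretic bookkeeping for `KNGoodThreeKN.core` (file `…KNGoodThreeRelaysKN.lean`): the two sides of the three-relay strong-goodness
inequality written over the separation events `D_K = {{a,t} ↮ c}`, `D_a = {a ↮ {t,c}}`, `D_t = {t ↮ {a,c}}` and the pocket-augmented events of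
the sources `{a,t}`, `{a}`, `{t}` — Kozma–Nitzan's decomposition `I + II + III` (arXiv:2401.12397, p. 8) with pockets.
[cite: KozmaNitzan2024, Thm. 2 (p. 8), §3.2 Definition (p. 12)] [cite: VandenbergHaggstromKahn2005, Thm. 1.1 (pp. 3–5)]
-/

noncomputable section

namespace Summit.CriticalPhenomena.PercolationContinuityZ3.Theorems

open MeasureTheory Set Literature.Probability.LatticeModels Literature.Probability.Percolation
open scoped Classical

namespace KNGoodThreeKN

open KNGoodPocketBHK

variable {V : Type*} [Fintype V]

/-- The pockets event `{C(o) ∈ 𝒬}`. [cite: KozmaNitzan2024, §3.2 (p. 12)] -/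
abbrev pk (o : V) (Q : Set (Set V)) : Set (BondConfig V) := {ω | openCluster ω o ∈ Q}

omit [Fintype V] in
/-- Membership in `avoidSet {x} {y, z}`. [folklore] -/
theorem mem_avoidSet_one_two (x y z : V) (ω : BondConfig V) :
    ω ∈ avoidSet ({x} : Set V) {y, z} ↔ ¬ (openGraph ω).Reachable x y ∧ ¬ (openGraph ω).Reachable x z := by
  simp only [avoidSet, Set.mem_setOf_eq, Set.mem_singleton_iff, Set.mem_insert_iff, forall_eq, forall_eq_or_imp]

omit [Fintype V] in
/-- Membership in `avoidSet {x, y} {z}`. [folklore] -/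
theorem mem_avoidSet_two_one (x y z : V) (ω : BondConfig V) :
    ω ∈ avoidSet ({x, y} : Set V) {z} ↔ ¬ (openGraph ω).Reachable x z ∧ ¬ (openGraph ω).Reachable y z := by
  simp only [avoidSet, Set.mem_setOf_eq, Set.mem_singleton_iff, Set.mem_insert_iff, forall_eq, forall_eq_or_imp]

omit [Fintype V] in
/-- Membership in `pocketAugSet {x} o Q`. [folklore] -/
theorem mem_pocketAugSet_one (x o : V) (Q : Set (Set V)) (ω : BondConfig V) :
    ω ∈ pocketAugSet ({x} : Set V) o Q ↔ (openGraph ω).Reachable o x ∨ openCluster ω o ∈ Q := by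
  simp only [pocketAugSet, Set.mem_setOf_eq, Set.mem_singleton_iff, exists_eq_left]

omit [Fintype V] in
/-- Membership in `pocketAugSet {x, y} o Q`. [folklore] -/
theorem mem_pocketAugSet_two (x y o : V) (Q : Set (Set V)) (ω : BondConfig V) :
    ω ∈ pocketAugSet ({x, y} : Set V) o Q ↔
      ((openGraph ω).Reachable o x ∨ (openGraph ω).Reachable o y) ∨ openCluster ω o ∈ Q := by
  simp only [pocketAugSet, Set.mem_setOf_eq, Set.mem_singleton_iff, Set.mem_insert_iff, exists_eq_or_imp,
    exists_eq_left]

/-- **The `−` terms of `I + II + III` with pockets**: `μ(c↔b, o↮b, o↔{a,t}) + μ(C(o)∈𝒬_a, c↔b, a↮b) + μ(C(o)∈𝒬_t, c↔b, t↮b)`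
`= μ({c↔b} ∩ F ∩ D_K) + μ({t↔c, t↔b} ∩ F_a ∩ D_a) + μ({a↔c, a↔b} ∩ F_t ∩ D_t)`. [cite: KozmaNitzan2024, Thm. 2 proof (p. 8)] -/
theorem real_lhs_eq (w : Sym2 V → unitInterval) (o b a t c : V) (Qa Qt : Set (Set V))
    (hQa : ∀ W ∈ Qa, a ∉ W ∧ t ∉ W ∧ c ∉ W) (hQt : ∀ W ∈ Qt, a ∉ W ∧ t ∉ W ∧ c ∉ W) (hdis : Disjoint Qa Qt) :
    (prodBernoulli w).real (openConn c b ∩ (openConn o b)ᶜ ∩ (openConn o a ∪ openConn o t)) +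
        (prodBernoulli w).real (pk o Qa ∩ (openConn c b ∩ (openConn a b)ᶜ)) +
        (prodBernoulli w).real (pk o Qt ∩ (openConn c b ∩ (openConn t b)ᶜ)) =
      (prodBernoulli w).real (openConn c b ∩ (pocketAugSet ({a, t} : Set V) o (Qa ∪ Qt) ∩ avoidSet ({a, t} : Set V) {c})) +
        (prodBernoulli w).real ((openConn t c ∩ openConn t b) ∩ (pocketAugSet ({a} : Set V) o Qa ∩ avoidSet ({a} : Set V) {t, c})) +
        (prodBernoulli w).real ((openConn a c ∩ openConn a b) ∩ (pocketAugSet ({t} : Set V) o Qt ∩ avoidSet ({t} : Set V) {a, c})) := by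
  classical
  set μ := prodBernoulli w with hμ
  haveI : IsProbabilityMeasure μ := by rw [hμ]; infer_instance
  have hmeas : ∀ A : Set (BondConfig V), MeasurableSet A := fun _ => MeasurableSet.of_discrete
  ---------------------------------------------------------------- events
  set DK : Set (BondConfig V) := avoidSet {a, t} {c} with hDK
  set Da : Set (BondConfig V) := avoidSet {a} {t, c} with hDa
  set Dt : Set (BondConfig V) := avoidSet {t} {a, c} with hDt
  set F : Set (BondConfig V) := pocketAugSet {a, t} o (Qa ∪ Qt) with hF
  set FA : Set (BondConfig V) := pocketAugSet {a} o Qa with hFA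
  set FT : Set (BondConfig V) := pocketAugSet {t} o Qt with hFT
  set h5 : Set (BondConfig V) := openConn a t ∩ (openConn a b ∪ openConn t b) with hh5
  set g : Set (BondConfig V) := openConn c b with hg
  set hab : Set (BondConfig V) := openConn a b with hhab
  set htb : Set (BondConfig V) := openConn t b with hhtb
  set g9 : Set (BondConfig V) := openConn t c ∩ openConn t b with hg9
  set g8 : Set (BondConfig V) := openConn a c ∩ openConn a b with hg8
  have memDK : ∀ ω, ω ∈ DK ↔ ¬ (openGraph ω).Reachable a c ∧ ¬ (openGraph ω).Reachable t c := fun ω => by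
    rw [hDK]; exact mem_avoidSet_two_one a t c ω
  have memDa : ∀ ω, ω ∈ Da ↔ ¬ (openGraph ω).Reachable a t ∧ ¬ (openGraph ω).Reachable a c := fun ω => by
    rw [hDa]; exact mem_avoidSet_one_two a t c ω
  have memDt : ∀ ω, ω ∈ Dt ↔ ¬ (openGraph ω).Reachable t a ∧ ¬ (openGraph ω).Reachable t c := fun ω => by
    rw [hDt]; exact mem_avoidSet_one_two t a c ω
  have memF : ∀ ω, ω ∈ F ↔ ((openGraph ω).Reachable o a ∨ (openGraph ω).Reachable o t) ∨
      openCluster ω o ∈ Qa ∪ Qt := fun ω => by rw [hF]; exact mem_pocketAugSet_two a t o _ ω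
  have memFA : ∀ ω, ω ∈ FA ↔ (openGraph ω).Reachable o a ∨ openCluster ω o ∈ Qa := fun ω => by
    rw [hFA]; exact mem_pocketAugSet_one a o Qa ω
  have memFT : ∀ ω, ω ∈ FT ↔ (openGraph ω).Reachable o t ∨ openCluster ω o ∈ Qt := fun ω => by
    rw [hFT]; exact mem_pocketAugSet_one t o Qt ω
  -- pockets exclude the relays from `C(o)`
  have pkQa : ∀ ω, openCluster ω o ∈ Qa → ¬ (openGraph ω).Reachable o a ∧ ¬ (openGraph ω).Reachable o t ∧
      ¬ (openGraph ω).Reachable o c := fun ω hW =>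
    ⟨fun h => (hQa _ hW).1 h, fun h => (hQa _ hW).2.1 h, fun h => (hQa _ hW).2.2 h⟩
  have pkQt : ∀ ω, openCluster ω o ∈ Qt → ¬ (openGraph ω).Reachable o a ∧ ¬ (openGraph ω).Reachable o t ∧
      ¬ (openGraph ω).Reachable o c := fun ω hW =>
    ⟨fun h => (hQt _ hW).1 h, fun h => (hQt _ hW).2.1 h, fun h => (hQt _ hW).2.2 h⟩
  have L1 : openConn c b ∩ (openConn o b)ᶜ ∩ (openConn o a ∪ openConn o t) ∪
      (pk o Qa ∩ (openConn c b ∩ (openConn a b)ᶜ) ∪ pk o Qt ∩ (openConn c b ∩ (openConn t b)ᶜ)) =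
      g ∩ (F ∩ DK) ∪ (g9 ∩ (FA ∩ Da) ∪ g8 ∩ (FT ∩ Dt)) := by
    ext ω
    simp only [Set.mem_union, Set.mem_inter_iff, Set.mem_compl_iff, memDK, memDa, memDt, memF, memFA, memFT, hg, hg9,
      hg8, openConn, Set.mem_setOf_eq, pk]
    constructor
    · rintro (⟨⟨hcb, hob⟩, hoa | hot⟩ | (⟨hq, hcb, hab'⟩ | ⟨hq, hcb, htb'⟩))
      · -- o ~ a, o !~ b, c ~ b
        by_cases htb' : (openGraph ω).Reachable t b
        · -- world 9-like: t ~ b ~ c, a alone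
          refine Or.inr (Or.inl ⟨⟨(htb'.trans hcb.symm), htb'⟩, Or.inl hoa, ?_, ?_⟩)
          · exact fun hat => hob (hoa.trans (hat.trans htb'))
          · exact fun hac => hob (hoa.trans (hac.trans hcb))
        · refine Or.inl ⟨hcb, Or.inl (Or.inl hoa), ?_, ?_⟩
          · exact fun hac => hob (hoa.trans (hac.trans hcb))
          · exact fun htc => htb' (htc.trans hcb)
      · by_cases hab' : (openGraph ω).Reachable a b
        · refine Or.inr (Or.inr ⟨⟨hab'.trans hcb.symm, hab'⟩, Or.inl hot, ?_, ?_⟩)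
          · exact fun hta => hob (hot.trans (hta.trans hab'))
          · exact fun htc => hob (hot.trans (htc.trans hcb))
        · refine Or.inl ⟨hcb, Or.inl (Or.inr hot), ?_, ?_⟩
          · exact fun hac => hab' (hac.trans hcb)
          · exact fun htc => hob (hot.trans (htc.trans hcb))
      · -- pocket of class a, c ~ b, a !~ b
        by_cases htb' : (openGraph ω).Reachable t b
        · refine Or.inr (Or.inl ⟨⟨htb'.trans hcb.symm, htb'⟩, Or.inr hq, ?_, ?_⟩)
          · exact fun hat => hab' (hat.trans htb')
          · exact fun hac => hab' (hac.trans hcb)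
        · refine Or.inl ⟨hcb, Or.inr (Or.inl hq), ?_, ?_⟩
          · exact fun hac => hab' (hac.trans hcb)
          · exact fun htc => htb' (htc.trans hcb)
      · by_cases hab' : (openGraph ω).Reachable a b
        · refine Or.inr (Or.inr ⟨⟨hab'.trans hcb.symm, hab'⟩, Or.inr hq, ?_, ?_⟩)
          · exact fun hta => htb' (hta.trans hab')
          · exact fun htc => htb' (htc.trans hcb)
        · refine Or.inl ⟨hcb, Or.inr (Or.inr hq), ?_, ?_⟩
          · exact fun hac => hab' (hac.trans hcb)
          · exact fun htc => htb' (htc.trans hcb)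
    · rintro (⟨hcb, hF', hac, htc⟩ | (⟨⟨htc, htb'⟩, hFA', hat, hac⟩ | ⟨⟨hac, hab'⟩, hFT', hta, htc⟩))
      · rcases hF' with (hoa | hot) | (hq | hq)
        · exact Or.inl ⟨⟨hcb, fun hob => hac (hoa.symm.trans (hob.trans hcb.symm))⟩, Or.inl hoa⟩
        · exact Or.inl ⟨⟨hcb, fun hob => htc (hot.symm.trans (hob.trans hcb.symm))⟩, Or.inr hot⟩
        · exact Or.inr (Or.inl ⟨hq, hcb, fun hab' => hac (hab'.trans hcb.symm)⟩)
        · exact Or.inr (Or.inr ⟨hq, hcb, fun htb' => htc (htb'.trans hcb.symm)⟩)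
      · rcases hFA' with hoa | hq
        · exact Or.inl ⟨⟨htc.symm.trans htb', fun hob => hat (hoa.symm.trans (hob.trans htb'.symm))⟩, Or.inl hoa⟩
        · exact Or.inr (Or.inl ⟨hq, htc.symm.trans htb', fun hab' => hat (hab'.trans htb'.symm)⟩)
      · rcases hFT' with hot | hq
        · exact Or.inl ⟨⟨hac.symm.trans hab', fun hob => hta (hot.symm.trans (hob.trans hab'.symm))⟩, Or.inr hot⟩
        · exact Or.inr (Or.inr ⟨hq, hac.symm.trans hab', fun htb' => hta (htb'.trans hab'.symm)⟩)
  have dX : Disjoint (openConn c b ∩ (openConn o b)ᶜ ∩ (openConn o a ∪ openConn o t) ∪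
      pk o Qa ∩ (openConn c b ∩ (openConn a b)ᶜ)) (pk o Qt ∩ (openConn c b ∩ (openConn t b)ᶜ)) ∧
      Disjoint (openConn c b ∩ (openConn o b)ᶜ ∩ (openConn o a ∪ openConn o t))
      (pk o Qa ∩ (openConn c b ∩ (openConn a b)ᶜ)) := by
    constructor
    · rw [Set.disjoint_union_left]
      constructor
      · rw [Set.disjoint_left]
        rintro ω ⟨-, hoa | hot⟩ ⟨hq, -⟩
        · exact (pkQt ω hq).1 hoa
        · exact (pkQt ω hq).2.1 hot
      · rw [Set.disjoint_left]
        rintro ω ⟨hqa, -⟩ ⟨hqt, -⟩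
        exact (Set.disjoint_left.1 hdis) hqa hqt
    · rw [Set.disjoint_left]
      rintro ω ⟨-, hoa | hot⟩ ⟨hq, -⟩
      · exact (pkQa ω hq).1 hoa
      · exact (pkQa ω hq).2.1 hot
  have dY : Disjoint (g ∩ (F ∩ DK) ∪ g9 ∩ (FA ∩ Da)) (g8 ∩ (FT ∩ Dt)) ∧
      Disjoint (g ∩ (F ∩ DK)) (g9 ∩ (FA ∩ Da)) := by
    constructor
    · rw [Set.disjoint_union_left]
      constructor
      · rw [Set.disjoint_left]
        rintro ω ⟨-, -, hDK'⟩ ⟨⟨hac, -⟩, -⟩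
        exact ((memDK ω).1 hDK').1 hac
      · rw [Set.disjoint_left]
        rintro ω ⟨-, -, hDa'⟩ ⟨⟨hac, -⟩, -⟩
        exact ((memDa ω).1 hDa').2 hac
    · rw [Set.disjoint_left]
      rintro ω ⟨-, -, hDK'⟩ ⟨⟨htc, -⟩, -⟩
      exact ((memDK ω).1 hDK').2 htc
  rw [← measureReal_union dX.2 (hmeas _), ← measureReal_union dX.1 (hmeas _), ← measureReal_union dY.2 (hmeas _),
    ← measureReal_union dY.1 (hmeas _), Set.union_assoc, Set.union_assoc, L1]

/-- **The `+` terms of `I + II + III` with pockets**: `μ(o↔b, c↮b, o↔{a,t}) + μ(C(o)∈𝒬_a, a↔b, c↮b) + μ(C(o)∈𝒬_t, t↔b, c↮b)`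
`= μ({a↔t, b∈C_{at}} ∩ F ∩ D_K) + μ({a↔b} ∩ F_a ∩ D_a) + μ({t↔b} ∩ F_t ∩ D_t)`. [cite: KozmaNitzan2024, Thm. 2 proof (p. 8)] -/
theorem real_rhs_eq (w : Sym2 V → unitInterval) (o b a t c : V) (Qa Qt : Set (Set V))
    (hQa : ∀ W ∈ Qa, a ∉ W ∧ t ∉ W ∧ c ∉ W) (hQt : ∀ W ∈ Qt, a ∉ W ∧ t ∉ W ∧ c ∉ W) (hdis : Disjoint Qa Qt) :
    (prodBernoulli w).real (openConn o b ∩ (openConn c b)ᶜ ∩ (openConn o a ∪ openConn o t)) +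
        (prodBernoulli w).real (pk o Qa ∩ (openConn a b ∩ (openConn c b)ᶜ)) +
        (prodBernoulli w).real (pk o Qt ∩ (openConn t b ∩ (openConn c b)ᶜ)) =
      (prodBernoulli w).real ((openConn a t ∩ (openConn a b ∪ openConn t b)) ∩ (pocketAugSet ({a, t} : Set V) o (Qa ∪ Qt) ∩ avoidSet ({a, t} : Set V) {c})) +
        (prodBernoulli w).real (openConn a b ∩ (pocketAugSet ({a} : Set V) o Qa ∩ avoidSet ({a} : Set V) {t, c})) +
        (prodBernoulli w).real (openConn t b ∩ (pocketAugSet ({t} : Set V) o Qt ∩ avoidSet ({t} : Set V) {a, c})) := by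
  classical
  set μ := prodBernoulli w with hμ
  haveI : IsProbabilityMeasure μ := by rw [hμ]; infer_instance
  have hmeas : ∀ A : Set (BondConfig V), MeasurableSet A := fun _ => MeasurableSet.of_discrete
  ---------------------------------------------------------------- events
  set DK : Set (BondConfig V) := avoidSet {a, t} {c} with hDK
  set Da : Set (BondConfig V) := avoidSet {a} {t, c} with hDa
  set Dt : Set (BondConfig V) := avoidSet {t} {a, c} with hDt
  set F : Set (BondConfig V) := pocketAugSet {a, t} o (Qa ∪ Qt) with hF
  set FA : Set (BondConfig V) := pocketAugSet {a} o Qa with hFA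
  set FT : Set (BondConfig V) := pocketAugSet {t} o Qt with hFT
  set h5 : Set (BondConfig V) := openConn a t ∩ (openConn a b ∪ openConn t b) with hh5
  set g : Set (BondConfig V) := openConn c b with hg
  set hab : Set (BondConfig V) := openConn a b with hhab
  set htb : Set (BondConfig V) := openConn t b with hhtb
  set g9 : Set (BondConfig V) := openConn t c ∩ openConn t b with hg9
  set g8 : Set (BondConfig V) := openConn a c ∩ openConn a b with hg8
  have memDK : ∀ ω, ω ∈ DK ↔ ¬ (openGraph ω).Reachable a c ∧ ¬ (openGraph ω).Reachable t c := fun ω => by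
    rw [hDK]; exact mem_avoidSet_two_one a t c ω
  have memDa : ∀ ω, ω ∈ Da ↔ ¬ (openGraph ω).Reachable a t ∧ ¬ (openGraph ω).Reachable a c := fun ω => by
    rw [hDa]; exact mem_avoidSet_one_two a t c ω
  have memDt : ∀ ω, ω ∈ Dt ↔ ¬ (openGraph ω).Reachable t a ∧ ¬ (openGraph ω).Reachable t c := fun ω => by
    rw [hDt]; exact mem_avoidSet_one_two t a c ω
  have memF : ∀ ω, ω ∈ F ↔ ((openGraph ω).Reachable o a ∨ (openGraph ω).Reachable o t) ∨
      openCluster ω o ∈ Qa ∪ Qt := fun ω => by rw [hF]; exact mem_pocketAugSet_two a t o _ ω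
  have memFA : ∀ ω, ω ∈ FA ↔ (openGraph ω).Reachable o a ∨ openCluster ω o ∈ Qa := fun ω => by
    rw [hFA]; exact mem_pocketAugSet_one a o Qa ω
  have memFT : ∀ ω, ω ∈ FT ↔ (openGraph ω).Reachable o t ∨ openCluster ω o ∈ Qt := fun ω => by
    rw [hFT]; exact mem_pocketAugSet_one t o Qt ω
  -- pockets exclude the relays from `C(o)`
  have pkQa : ∀ ω, openCluster ω o ∈ Qa → ¬ (openGraph ω).Reachable o a ∧ ¬ (openGraph ω).Reachable o t ∧
      ¬ (openGraph ω).Reachable o c := fun ω hW =>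
    ⟨fun h => (hQa _ hW).1 h, fun h => (hQa _ hW).2.1 h, fun h => (hQa _ hW).2.2 h⟩
  have pkQt : ∀ ω, openCluster ω o ∈ Qt → ¬ (openGraph ω).Reachable o a ∧ ¬ (openGraph ω).Reachable o t ∧
      ¬ (openGraph ω).Reachable o c := fun ω hW =>
    ⟨fun h => (hQt _ hW).1 h, fun h => (hQt _ hW).2.1 h, fun h => (hQt _ hW).2.2 h⟩
  have R1 : openConn o b ∩ (openConn c b)ᶜ ∩ (openConn o a ∪ openConn o t) ∪
      (pk o Qa ∩ (openConn a b ∩ (openConn c b)ᶜ) ∪ pk o Qt ∩ (openConn t b ∩ (openConn c b)ᶜ)) =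
      h5 ∩ (F ∩ DK) ∪ (hab ∩ (FA ∩ Da) ∪ htb ∩ (FT ∩ Dt)) := by
    ext ω
    simp only [Set.mem_union, Set.mem_inter_iff, Set.mem_compl_iff, memDK, memDa, memDt, memF, memFA, memFT, hh5,
      hhab, hhtb, openConn, Set.mem_setOf_eq, pk]
    constructor
    · rintro (⟨⟨hob, hcb⟩, hoa | hot⟩ | (⟨hq, hab', hcb⟩ | ⟨hq, htb', hcb⟩))
      · by_cases hat : (openGraph ω).Reachable a t
        · refine Or.inl ⟨⟨hat, Or.inl (hoa.symm.trans hob)⟩, Or.inl (Or.inl hoa), ?_, ?_⟩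
          · exact fun hac => hcb (hac.symm.trans (hoa.symm.trans hob))
          · exact fun htc => hcb (htc.symm.trans (hat.symm.trans (hoa.symm.trans hob)))
        · refine Or.inr (Or.inl ⟨hoa.symm.trans hob, Or.inl hoa, hat, ?_⟩)
          exact fun hac => hcb (hac.symm.trans (hoa.symm.trans hob))
      · by_cases hat : (openGraph ω).Reachable a t
        · refine Or.inl ⟨⟨hat, Or.inr (hot.symm.trans hob)⟩, Or.inl (Or.inr hot), ?_, ?_⟩
          · exact fun hac => hcb (hac.symm.trans (hat.trans (hot.symm.trans hob)))
          · exact fun htc => hcb (htc.symm.trans (hot.symm.trans hob))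
        · refine Or.inr (Or.inr ⟨hot.symm.trans hob, Or.inl hot, fun hta => hat hta.symm, ?_⟩)
          exact fun htc => hcb (htc.symm.trans (hot.symm.trans hob))
      · by_cases hat : (openGraph ω).Reachable a t
        · refine Or.inl ⟨⟨hat, Or.inl hab'⟩, Or.inr (Or.inl hq), ?_, ?_⟩
          · exact fun hac => hcb (hac.symm.trans hab')
          · exact fun htc => hcb (htc.symm.trans (hat.symm.trans hab'))
        · exact Or.inr (Or.inl ⟨hab', Or.inr hq, hat, fun hac => hcb (hac.symm.trans hab')⟩)
      · by_cases hat : (openGraph ω).Reachable a t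
        · refine Or.inl ⟨⟨hat, Or.inr htb'⟩, Or.inr (Or.inr hq), ?_, ?_⟩
          · exact fun hac => hcb (hac.symm.trans (hat.trans htb'))
          · exact fun htc => hcb (htc.symm.trans htb')
        · exact Or.inr (Or.inr ⟨htb', Or.inr hq, fun hta => hat hta.symm, fun htc => hcb (htc.symm.trans htb')⟩)
    · rintro (⟨⟨hat, hb⟩, hF', hac, htc⟩ | (⟨hab', hFA', hat, hac⟩ | ⟨htb', hFT', hta, htc⟩))
      · have hab' : (openGraph ω).Reachable a b := by
          rcases hb with h | h
          · exact h
          · exact hat.trans h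
        have htb' : (openGraph ω).Reachable t b := hat.symm.trans hab'
        have hcb : ¬ (openGraph ω).Reachable c b := fun h => hac (hab'.trans h.symm)
        rcases hF' with (hoa | hot) | (hq | hq)
        · exact Or.inl ⟨⟨hoa.trans hab', hcb⟩, Or.inl hoa⟩
        · exact Or.inl ⟨⟨hot.trans htb', hcb⟩, Or.inr hot⟩
        · exact Or.inr (Or.inl ⟨hq, hab', hcb⟩)
        · exact Or.inr (Or.inr ⟨hq, htb', hcb⟩)
      · have hcb : ¬ (openGraph ω).Reachable c b := fun h => hac (hab'.trans h.symm)
        rcases hFA' with hoa | hq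
        · exact Or.inl ⟨⟨hoa.trans hab', hcb⟩, Or.inl hoa⟩
        · exact Or.inr (Or.inl ⟨hq, hab', hcb⟩)
      · have hcb : ¬ (openGraph ω).Reachable c b := fun h => htc (htb'.trans h.symm)
        rcases hFT' with hot | hq
        · exact Or.inl ⟨⟨hot.trans htb', hcb⟩, Or.inr hot⟩
        · exact Or.inr (Or.inr ⟨hq, htb', hcb⟩)
  have dX' : Disjoint (openConn o b ∩ (openConn c b)ᶜ ∩ (openConn o a ∪ openConn o t) ∪
      pk o Qa ∩ (openConn a b ∩ (openConn c b)ᶜ)) (pk o Qt ∩ (openConn t b ∩ (openConn c b)ᶜ)) ∧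
      Disjoint (openConn o b ∩ (openConn c b)ᶜ ∩ (openConn o a ∪ openConn o t))
      (pk o Qa ∩ (openConn a b ∩ (openConn c b)ᶜ)) := by
    constructor
    · rw [Set.disjoint_union_left]
      constructor
      · rw [Set.disjoint_left]
        rintro ω ⟨-, hoa | hot⟩ ⟨hq, -⟩
        · exact (pkQt ω hq).1 hoa
        · exact (pkQt ω hq).2.1 hot
      · rw [Set.disjoint_left]
        rintro ω ⟨hqa, -⟩ ⟨hqt, -⟩
        exact (Set.disjoint_left.1 hdis) hqa hqt
    · rw [Set.disjoint_left]
      rintro ω ⟨-, hoa | hot⟩ ⟨hq, -⟩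
      · exact (pkQa ω hq).1 hoa
      · exact (pkQa ω hq).2.1 hot
  have dY' : Disjoint (h5 ∩ (F ∩ DK) ∪ hab ∩ (FA ∩ Da)) (htb ∩ (FT ∩ Dt)) ∧
      Disjoint (h5 ∩ (F ∩ DK)) (hab ∩ (FA ∩ Da)) := by
    constructor
    · rw [Set.disjoint_union_left]
      constructor
      · rw [Set.disjoint_left]
        rintro ω ⟨⟨hat, -⟩, -, -⟩ ⟨-, -, hDt'⟩
        exact ((memDt ω).1 hDt').1 hat.symm
      · rw [Set.disjoint_left]
        rintro ω ⟨hab', -, hDa'⟩ ⟨htb', -, -⟩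
        have hab'' : (openGraph ω).Reachable a b := hab'
        have htb'' : (openGraph ω).Reachable t b := htb'
        exact ((memDa ω).1 hDa').1 (hab''.trans htb''.symm)
    · rw [Set.disjoint_left]
      rintro ω ⟨⟨hat, -⟩, -, -⟩ ⟨-, -, hDa'⟩
      exact ((memDa ω).1 hDa').1 hat
  rw [← measureReal_union dX'.2 (hmeas _), ← measureReal_union dX'.1 (hmeas _), ← measureReal_union dY'.2 (hmeas _),
    ← measureReal_union dY'.1 (hmeas _), Set.union_assoc, Set.union_assoc, R1]


end KNGoodThreeKN

end Summit.CriticalPhenomena.PercolationContinuityZ3.Theorems
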